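import Summits.ResolutionOfSingularities.ResolutionOfSingularities.Theorems.HilbertSamuelEliminationCampaignW42NearFibreOfDirDimEq
import Summits.ResolutionOfSingularities.ResolutionOfSingularities.Theorems.HilbertSamuelEliminationCampaignW42RidgeDimMonotoneOfThm3104
import HarnessLib

/-!
# [OURS · L1 W4.2] The RIDGE form of CJS Thm. 3.14's numerical shadow, UNCONDITIONAL: a near point over `x ∈ D` forces
# `dim 𝒪_{D,x} < dim F_x(X) = ē_x(X)` — every characteristic, every residue field, NO hypothesis on `e`/`ē`/`char`, NO named fact
# (campaign s42, cell res-hironaka; informal crux `RidgeConfinement`, stmt-ResolutionOfSingularities-17845 — the numerical half of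
# Dietel's F-54 (8.2.7) (ii) «`x' ∈ ℙ Rid(C_{X,x}/T_{D,x})`» PROVED on excellent schemes; `--supports`)

HONEST FRAMING. OURS (slot W4.2, prover res-L1-s42-pv-1, gen 4). The campaign's confinement theorem (p513085/p525202: the direction
`ū` of a near point is a `κ(x')`-point of Giraud's ridge of the fibre cone `C_{X,D,x}`) has a NUMERICAL shadow that needs no directrix
hypothesis at all: since some coordinate of `ū` is non-zero, the ridge `F(J_D)` is positive-dimensional, and by Hironaka–Grothendieck
at the near point (tree theorem `HerrmannIkedaOrbanz1988_cor_21_11_holds`) `dim F_x(X) = dim F(J_D) + dim 𝒪_{D,x}`. Hence: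

* `one_le_ridgeDim_of_mem_ridge` — a homogeneous `J ⊆ K[X]` whose ridge has a `κ'`-point with a non-zero coordinate (any field
  `κ' ⊇ K`) has `dim F(J) ≥ 1` (`dim F(J) = e(J_L)` for the PERFECT field `L = κ'^{alg}`, Dietel (6.3.5) (ii)_holds, and `F(J_L)_red =
  Dir(J_L)`);
* **`ringKrullDim_quotient_lt_ridgeDim_of_near`** — `X` excellent, `D` permissible, `π` a blow-up in `D`, `x' ∈ X'` over `x ∈ V(D)`
  near at ANY level `N`: `dim 𝒪_{D,x} < dim F_x(X)`; **`ringKrullDim_quotient_lt_geomDirDim_of_near`** — `… < ē_x(X)`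
  (`ridgeDim_eq_geomDirDim`); and the contrapositive **`not_near_of_geomDirDim_le`** — if `ē_x(X) ≤ dim 𝒪_{D,x}` (e.g. a SURFACE
  centre through a point with `ē ≤ 2`, or a curve centre through a point with `ē ≤ 1`) then NO point over `x` is near to `x`.

Compare the binder `Moving.Theorem314_geomDir` (`dim 𝒪_{D,x} < e_x(X)` under (F1♯), resting on F-51′): the conclusion here is
weaker (`ē` for `e`) but holds with NO hypothesis — in the corridor `ē ≤ 2` it already kills near points over surface centres.
NOTHING here is a statement of H. Hironaka's manuscript [Hironaka2017]. AI review is weaker than expert review. References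
(orientation only): V. Cossart, U. Jannsen, S. Saito, LNM 2270 (2020), Thm. 3.14, Rem. 18.29 (1); B. Dietel (2015), Thm. (8.2.7) (ii),
Lemma (6.3.5) (ii); J. Giraud (1975), Cor. 2.4.
-/

noncomputable section

-- single-conjunct summit: the doubled namespace component `ResolutionOfSingularities` is mandated
set_option linter.dupNamespace false

open CategoryTheory AlgebraicGeometry TopologicalSpace IsLocalRing MvPolynomial
open Literature.AlgebraicGeometry.Resolution Literature.AlgebraicGeometry.Resolution.HironakaScheme
open Literature.RingTheory.HilbertSamuel Literature.RingTheory.MvPolynomial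
open Literature.AlgebraicGeometry.CossartJannsenSaito2020
open Summit.ResolutionOfSingularities.ResolutionOfSingularities.Theorems.SigmaMaxModificationsCorridor3.Directrix214Sharp

namespace Summit.ResolutionOfSingularities.ResolutionOfSingularities.Theorems

namespace CampaignW42

universe u

/-! ## Cones: a non-zero field-valued point of the ridge makes it positive-dimensional -/

section Cones

variable {K : Type u} [Field K] {m : ℕ}

/-- **`dim F(J) ≥ 1` as soon as `F(J)` has a `κ'`-point with a non-zero coordinate** (`κ' ⊇ K` any field, `J` homogeneous):
`dim F(J) = e(J_L)` for the perfect `L = κ'^{alg}` (Dietel (6.3.5) (ii)), and over `L` every linear form of `𝒯(J_L) = √𝔉(J_L)_1`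
kills the point; if `e(J_L) = 0` all linear forms do. [cite: Dietel2015, Lemma (6.3.5) (ii) p. 76] [cite: Giraud1975, §1.5] -/
theorem one_le_ridgeDim_of_mem_ridge {J : Ideal (MvPolynomial (Fin m) K)} (hJ : IsHomogeneousIdeal J)
    {κ' : Type u} [Field κ'] [Algebra K κ'] {v : Fin m → κ'} (hv : v ∈ ridge κ' J) {i : Fin m} (hi : v i ≠ 0) :
    1 ≤ ridgeDim J := by
  classical
  let L := AlgebraicClosure κ'
  -- `dim F(J) = e(J_L)`
  have hD := radical_ridgeIdeal_coneIdeal_eq_and_ridgeDim_eq J hJ L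
  rw [hD.2]
  by_contra h0
  have h0' : directrixDim (coneIdeal L J) = 0 := by omega
  -- then `𝒯(J_L)` is everything, in particular `X_i ∈ √𝔉(J_L)`
  haveI : FiniteDimensional L (directrixSpace (coneIdeal L J)) :=
    Submodule.finiteDimensional_of_le (directrixSpace_le_one _)
  have hS1 : Module.finrank L (homogeneousSubmodule (Fin m) L 1) = m := by
    rw [← range_linForm, LinearMap.finrank_range_of_inj linForm_injective, Module.finrank_fin_fun]
  haveI : FiniteDimensional L (homogeneousSubmodule (Fin m) L 1) := by
    rw [← range_linForm]; infer_instance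
  have hfull : directrixSpace (coneIdeal L J) = homogeneousSubmodule (Fin m) L 1 := by
    refine Submodule.eq_of_le_of_finrank_le (directrixSpace_le_one _) ?_
    have h1 := finrank_directrixSpace_add_directrixDim (I := coneIdeal L J)
    rw [h0', add_zero] at h1
    rw [h1, hS1]
  have hXi : (X i : MvPolynomial (Fin m) L) ∈ (ridgeIdeal (coneIdeal L J)).radical := by
    rw [hD.1]
    refine Ideal.subset_span ?_
    change X i ∈ directrixSpace (coneIdeal L J)
    rw [hfull]
    exact (mem_homogeneousSubmodule 1 _).mpr (isHomogeneous_X L i)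
  -- the point `v`, pushed to `L`, lies in `F(J_L)` and is killed by `X_i`
  let φ : κ' →ₐ[K] L := IsScalarTower.toAlgHom K κ' L
  have hv' : (fun j => φ (v j)) ∈ ridge L (coneIdeal L J) := by
    rw [coneIdeal, ridge_map_eq L]
    exact map_mem_ridge φ hv
  have h := aeval_eq_zero_of_mem_ridge_of_mem_radical hv' hXi
  rw [aeval_X] at h
  exact hi ((map_eq_zero_iff φ (algebraMap κ' L).injective).mp h)

end Cones

/-! ## Schemes: `dim 𝒪_{D,x} < dim F_x(X)` at a near point — unconditional -/

section Schemes

variable {X X' : Scheme.{u}} [IsLocallyNoetherian X] {π : X' ⟶ X} {D : X.IdealSheafData}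

/-- **`dim 𝒪_{D,x} < dim F_x(X)` at a near point of a permissible blow-up — every characteristic, no hypothesis on `e`, `ē` or the
residue field.** `X` excellent, `D` permissible, `π : X' → X` a blow-up in `D`, `x' ∈ X'` over `x ∈ V(D)` near at any level `N`
(`H^N_{X'}(x') = H^N_X(x)`): then `dim 𝒪_{D,x} < dim F_x(X)` (`Scheme.ridgeDim`). The numerical half of Dietel (8.2.7) (ii) on excellent
schemes, from this campaign's ridge confinement in the fibre cone (`residue_mem_ridge_normalConeIdeal_of_isNearPoint`) and
Hironaka–Grothendieck at the near point (tree theorem). [cite: Dietel2015, Thm. (8.2.7) (ii) p. 105] [cite: CossartJannsenSaito2020, Rem. 18.29 (1)] -/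
theorem ringKrullDim_quotient_lt_ridgeDim_of_near (hX : Scheme.IsExcellent X) (hperm : IdealSheafData.IsPermissible D)
    (hπ : IsBlowup π D) {N : ℕ} (x' : X') (hxD : π.base x' ∈ (D.support : Set X))
    (hnear : Scheme.hsFun X' N x' = Scheme.hsFun X N (π.base x')) :
    ringKrullDim (X.presheaf.stalk (π.base x') ⧸ stalkIdeal D (π.base x')) < (Scheme.ridgeDim X (π.base x') : WithBot ℕ∞) := by
  classical
  haveI : IsLocalHom (π.stalkMap x').hom := π.toLRSHom.prop x'
  letI algκ : Algebra (ResidueField (X.presheaf.stalk (π.base x'))) (ResidueField (X'.presheaf.stalk x')) :=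
    (ResidueField.map (π.stalkMap x').hom).toAlgebra
  have hIperm : (stalkIdeal D (π.base x')).IsPermissible := hperm _ hxD
  -- minimal generators and the numerics of Hironaka–Grothendieck
  obtain ⟨n, s, g, y, hz, hgI, hn, hdimI, hE, hJz⟩ :=
    exists_minimal_generators_data HerrmannIkedaOrbanz1988_cor_21_11_holds hIperm
  -- chart data `(t, u)` at `x'`
  obtain ⟨t, ht, hspan⟩ := hπ.isEffectiveCartier.exists_stalkIdeal_eq_span x'
  have hmap : (stalkIdeal D (π.base x')).map (π.stalkMap x').hom = Ideal.span {t} := by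
    rw [← hspan, stalkIdeal_comap_eq_map_stalkMap]
  have hu : ∀ i, ∃ ui : X'.presheaf.stalk x', (π.stalkMap x').hom (g i) = ui * t := by
    intro i
    have hmem : (π.stalkMap x').hom (g i) ∈ (stalkIdeal D (π.base x')).map (π.stalkMap x').hom := by
      refine Ideal.mem_map_of_mem _ ?_
      rw [← hgI]
      exact Ideal.subset_span ⟨i, rfl⟩
    rw [hmap, Ideal.mem_span_singleton'] at hmem
    obtain ⟨ui, hui⟩ := hmem
    exact ⟨ui, hui.symm⟩
  choose u hu using hu
  -- the direction lies in the ridge of `J_D`, with a non-zero coordinate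
  have hū := residue_mem_ridge_normalConeIdeal_of_isNearPoint hπ x' (hperm _ hxD) (hX.isUniversallyCatenaryRing_stalk _)
    (N := N) hnear g hgI t ht hmap u hu
  obtain ⟨i₀, hi₀⟩ := exists_X_not_mem_chartPrime_of_map_eq (π.stalkMap x').hom hgI ht hmap hu
  have hne : residue (X'.presheaf.stalk x') (u i₀) ≠ 0 := by
    intro h0
    apply hi₀
    rw [mem_chartPrime_iff_of_isHomogeneous (π.stalkMap x').hom u (isHomogeneous_X _ i₀), chartEval_X]
    exact h0
  have hone : 1 ≤ ridgeDim (normalConeIdeal g) :=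
    one_le_ridgeDim_of_mem_ridge (isHomogeneousIdeal_normalConeIdeal g) hū hne
  -- `dim F_x(X) = dim F(J_D) + s`
  let L := AlgebraicClosure (ResidueField (X.presheaf.stalk (π.base x')))
  have hR : Scheme.ridgeDim X (π.base x') = ridgeDim (normalConeIdeal g) + s := by
    change localRidgeDim (X.presheaf.stalk (π.base x')) = _
    rw [localRidgeDim_eq_dirDimOver_of_perfectField (X.presheaf.stalk (π.base x')) L,
      dirDimOver_eq' (X.presheaf.stalk (π.base x')) L hE (Fin.append g y) hz, hJz, map_map_rename_eq,
      directrixDim_map_rename_castAdd]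
    congr 1
    exact (radical_ridgeIdeal_coneIdeal_eq_and_ridgeDim_eq (normalConeIdeal g) (isHomogeneousIdeal_normalConeIdeal g) L).2.symm
  rw [hdimI, hR]
  exact_mod_cast (show s < ridgeDim (normalConeIdeal g) + s by omega)

/-- **`dim 𝒪_{D,x} < ē_x(X)` at a near point of a permissible blow-up, unconditionally** (`dim F_x(X) = ē_x(X)`,
`ridgeDim_eq_geomDirDim`). The binder `Moving.Theorem314_geomDir` concludes `< e_x(X)` under (F1♯); this weaker conclusion needs
nothing. [cite: CossartJannsenSaito2020, Thm. 3.14, Rem. 18.29 (1)] [cite: Dietel2015, Thm. (8.2.7) (ii) p. 105] -/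
theorem ringKrullDim_quotient_lt_geomDirDim_of_near (hX : Scheme.IsExcellent X) (hperm : IdealSheafData.IsPermissible D)
    (hπ : IsBlowup π D) {N : ℕ} (x' : X') (hxD : π.base x' ∈ (D.support : Set X))
    (hnear : Scheme.hsFun X' N x' = Scheme.hsFun X N (π.base x')) :
    ringKrullDim (X.presheaf.stalk (π.base x') ⧸ stalkIdeal D (π.base x')) <
      (Scheme.geomDirDim X (π.base x') : WithBot ℕ∞) := by
  rw [← ridgeDim_eq_geomDirDim]
  exact ringKrullDim_quotient_lt_ridgeDim_of_near hX hperm hπ x' hxD hnear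

/-- **No near point over a point where the centre is too big for the ridge**: if `ē_x(X) ≤ dim 𝒪_{D,x}` (e.g. a SURFACE centre
through a point with `ē_x ≤ 2`, a CURVE centre through a point with `ē_x ≤ 1`), then no point of `X'` over `x` is near to `x`
— every characteristic, no named fact. [cite: CossartJannsenSaito2020, Thm. 3.14, Lemma 3.15 (2)] -/
theorem not_near_of_geomDirDim_le (hX : Scheme.IsExcellent X) (hperm : IdealSheafData.IsPermissible D)
    (hπ : IsBlowup π D) {N : ℕ} (x' : X') (hxD : π.base x' ∈ (D.support : Set X))
    (hle : (Scheme.geomDirDim X (π.base x') : WithBot ℕ∞) ≤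
      ringKrullDim (X.presheaf.stalk (π.base x') ⧸ stalkIdeal D (π.base x'))) :
    Scheme.hsFun X' N x' ≠ Scheme.hsFun X N (π.base x') := fun hnear =>
  (lt_irrefl _) ((ringKrullDim_quotient_lt_geomDirDim_of_near hX hperm hπ x' hxD hnear).trans_le hle)

end Schemes

end CampaignW42

end Summit.ResolutionOfSingularities.ResolutionOfSingularities.Theorems

end
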